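import Literature.MathematicalPhysics.QuantumFieldTheory.Balaban1983to89.B13ChainJointNonvacuityPrefactors

/-!
# `Balaban1983to89.B13ChainJointNonvacuityPrefactorsBond` — T. Bałaban, *Renormalization group approach to lattice gauge field theories.
II. Cluster expansions*, Commun. Math. Phys. **116** (1988) 1–22, doi:10.1007/bf01239022 [Balaban1988RG2Cluster]:
**the joint witness of `B13ChainJointNonvacuityPrefactors` AT EVERY BOND FINENESS of the layer, and the junction-level bound on the (1.24)
prefactor that the displayed shapes alone impose**

statement-level skeleton of published theorems with citation tags; proofs where landed; nothing here is a claim about the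
Yang–Mills mass gap

CITATION HEADER (verbatim).  p. 12 [PDF 12], (2.3): the terms of `H` live on bonds of the finer lattice (*"b ⊂ B_{k+1}, … of the lattice
T^{(k+1)}_{η}"* — the bond fineness `M` of the junction's `Lemma3Numerics c M ℓ …`, = the layer's `m₃ + 1`); p. 18 [PDF 18], after (2.31):
*"the number of such bonds is bounded by 2·4·M⁴"*-type count entering `2·4·M⁴·e^{−a∕10} ≤ a∕20`; p. 8 [PDF 8], (1.29): *"|Σ(1.23)| ≦ E₀ε₁O(M^q)
exp O(1)κ₁ exp(−½κ₁d_k(Y))"* and *"Another possibility is to use the expression g_k|B| instead of ε₁"* (the per-term bounds behind (1.36) CARRY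
`E₀ε₁`); p. 21, closing paragraph.  NOT PRINTED: every explicit number below — witness data ∕ located algebra on typed hypothesis lists.

WHY THIS FILE (cell `pub-ymgap`, node N10 = [B13], seat `pub-ymgap-dag-n10-w3` g3; own-stem successor of p607038 ∕ p608206).  Every A6 witness of
the N10 chain so far (n10-b `chain_joint_nonvacuous`, n10-w1 `chain_joint_nonvacuous_226`, this seat's `junction_numerals_joint_witness(_of_activity)`)
inhabits the junction's `hN : Lemma3Numerics (c13OfRecord θ layer) (m₃ + 1) ((ℓ₆+1)∕2) a a₂ a₂′ a₅ A_abs` at bond-cube side `m₃ + 1 = 1` ONLY: the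
(2.31) count conjunct `2·4·M⁴·e^{−a∕10} ≤ a∕20` was met at `M = 1` with the rate `a = aw`.  The record's `m₃` is def-T's letter ((2.3)).  §1–§2
remove that restriction (rate `a := aw + 40·log(m₃ + 1)`; every other `a`-conjunct is one-sided or monotone in `a`).  §3 records, as ONE located
inequality, what the displayed shapes of the junction (67 ∕ 67R ∕ 67RD) impose on the (1.24) prefactor `K` of `h124` at ANY inhabitant with one
term of non-empty 𝐃-support — the number the in-edge suppliers of `h124` (N09 ∕ N07 ∕ def-T's term tower) must deliver at the record.

WHAT THIS FILE PROVES (0 `sorry`, 0 `def`; theorems only).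
§1 `constsQ8A_numerics_bond` — for every `M_b ≥ 1`: `Lemma3Numerics (constsQ8A M α₄) M_b (L∕2) (aw + 40·log M_b) 1 1 ½ 1`.
§2 ★★ `junction_numerals_joint_witness_of_activity_bond (m₃ : ℕ)` — `B13ChainJointNonvacuityPrefactors.junction_numerals_joint_witness_of_activity`
   with `hN` at the junction's arity `(m₃ + 1, L∕2)` and p. 17's `hPa` at the matching rate; every other conjunct VERBATIM (same record, same `cp`, same
   reference package, same prefactors).
§3 ★ `K_le_of_junction_shapes` — `hC ∧ hτ2 ∧ 0 ≤ θ₁ ≤ 1 ∧ hcount(one term, #⋃𝐃 ≥ 1) ∧ hN.habs ∧ hN.hAc ∧ hN.hδ7 ∧ hN.hκ ∧ hR8 ⟹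
   K ≤ (κ₁ − 1)·ℓ·|Z|·e^{−1−(12⁴−1)κ₁∕8} ∕ (6144·K₀(64,8)²·2(6L)⁴·#⋃𝐃)`.

HONEST SCOPE.  Consistency of typed inequality lists + pure algebra on displayed shapes; nothing about Bałaban's constants; the junction's OBJECT
binders are NOT inhabited; no single inhabitant of all ≈ 160 binders is claimed; §3 is a LOCATOR for the eventual object-level inhabitant (print's
(1.29) says the per-term prefactor carries `E₀ε₁`, and p. 21 chooses `ε₁` after `κ₁` — consistent, NOT a gap).  Count-neutral; N10 NOT discharged;
K1⁷ NOT claimed; one finite four-torus programme at fixed ε; nothing continuum ∕ ℝ⁴ ∕ OS ∕ mass-gap ∕ Clay.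
-/

noncomputable section

namespace Literature.MathematicalPhysics.QuantumFieldTheory.Balaban1983to89.B13ChainJointNonvacuityPrefactorsBond

open Literature.MathematicalPhysics.QuantumFieldTheory.Balaban1983to89
open Literature.MathematicalPhysics.QuantumFieldTheory.Balaban1983to89.B12TreeDecay (kappa₀ K₀ K₀_pos kappa₀_nonneg)
open Literature.MathematicalPhysics.QuantumFieldTheory.Balaban1983to89.B13Bound143 (invTau R12)
open Literature.MathematicalPhysics.QuantumFieldTheory.Balaban1983to89.B13Lemma3WindowNonvacuity (κw aw)
open Literature.MathematicalPhysics.QuantumFieldTheory.Balaban1983to89.B13Lemma3TorusNonvacuity (κ₁t ε₁t)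
open Literature.MathematicalPhysics.QuantumFieldTheory.Balaban1983to89.B13Lemma3TorusSocket (Lemma3Numerics)
open Literature.MathematicalPhysics.QuantumFieldTheory.Balaban1983to89.B13NodeTorusFamilyNonvacuity (aw_pos)
open Literature.MathematicalPhysics.QuantumFieldTheory.Balaban1983to89.B13Bound226Numerals (theta0Max gamma2Max m4Min)
open Literature.MathematicalPhysics.QuantumFieldTheory.Balaban1983to89.B13ChainJointNonvacuityPrefactors
  (constsQ8A constsQ8A_numerics junction_numerals_joint_witness_of_activity K_le_of_hC_hτ2 alpha4_le_of_count)
open Literature.MathematicalPhysics.QuantumFieldTheory.Balaban1983to89.B13EntrywiseBlockNumerals (kbarFloor)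
open Literature.MathematicalPhysics.QuantumFieldTheory.Balaban1983to89.B13RungDialNumerals (radiusStar alphaMax rsigmaMin)
open Literature.MathematicalPhysics.QuantumFieldTheory.Balaban1983to89.NodeOLettersOfWalksAcross (WalkPackage)
open Literature.MathematicalPhysics.QuantumFieldTheory.Balaban1983to89.NodeOLettersOfWalksPerturbative (RefPackage)

/-! ## §1. The `hN` bundle at every bond fineness: rate `a := aw + 40·log M_b` -/

section Bond

variable {M a : ℝ}

/-- `memberF` is monotone in its (non-negative) argument when `ε₂ ≥ 0`. [cite: Balaban1988RG2Cluster, (2.37) p.20] -/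
private theorem memberF_mono (c : B13.Consts) (hε : 0 ≤ c.eps2) {X X' : ℝ} (h : X ≤ X') :
    B13Step237.memberF c X ≤ B13Step237.memberF c X' := by
  show ((c.L : ℝ) + 2) ^ 4 * X * c.eps2 ≤ ((c.L : ℝ) + 2) ^ 4 * X' * c.eps2
  have hL : 0 ≤ ((c.L : ℝ) + 2) ^ 4 := by positivity
  exact mul_le_mul_of_nonneg_right (mul_le_mul_of_nonneg_left h hL) hε

/-- The argument `X(a) = K₀(64,8)·e^{64e^{−a∕20}}` of `R18half ∕ R18sharp ∕ hC3` is antitone in the rate `a`. [cite: Balaban1988RG2Cluster, p.20 (before (2.37))] -/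
private theorem argX_antitone {a b : ℝ} (h : a ≤ b) :
    K₀ 64 8 * Real.exp (Real.exp (-(b / 20)) * 64) ≤ K₀ 64 8 * Real.exp (Real.exp (-(a / 20)) * 64) := by
  have hK₀ : 0 < K₀ 64 8 := K₀_pos 64 8
  refine mul_le_mul_of_nonneg_left (Real.exp_le_exp.2 ?_) hK₀.le
  exact mul_le_mul_of_nonneg_right (Real.exp_le_exp.2 (by linarith)) (by norm_num)

/-- ★ **THE JUNCTION's `hN` AT EVERY BOND FINENESS.**  For every bond-cube side `M_b ≥ 1` the bundle `Lemma3Numerics (constsQ8A M a) M_b (L∕2)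
(aw + 40·log M_b) 1 1 ½ 1` holds on the family (`M ≥ κw + 1`, `a > 0`): the (2.31) count `2·4·M_b⁴·e^{−a∕10} ≤ a∕20` at the rate
`aw + 40·log M_b` (`e^{−(aw + 40 log M_b)∕10} = e^{−aw∕10}·M_b^{−4}`), the one-sided conjuncts `hR16 hR16′ hR17 habsk` and the monotone ones
`h18half h18 hC3` (through `X(a) ≤ X(aw)`) from the `M_b = 1` bundle `constsQ8A_numerics`, the rest verbatim.
[cite: Balaban1988RG2Cluster, (2.3) p.12, (2.29)–(2.32) p.18, p.20 (restrictions on the constants), p.21 (closing paragraph)] -/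
theorem constsQ8A_numerics_bond (hM : κw + 1 ≤ M) (ha : 0 < a) (Mb : ℕ) (hMb : 1 ≤ Mb) :
    Lemma3Numerics (constsQ8A M a) Mb (((constsQ8A M a).L : ℝ) / 2) (aw + 40 * Real.log Mb) 1 1 (1 / 2) 1 := by
  have N := constsQ8A_numerics hM ha
  have hMb0 : (0 : ℝ) < (Mb : ℝ) := by exact_mod_cast hMb
  have hlog : 0 ≤ Real.log (Mb : ℝ) := Real.log_nonneg (by exact_mod_cast hMb)
  have hle : aw ≤ aw + 40 * Real.log Mb := by linarith
  have hX := argX_antitone hle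
  -- the (2.31) count at the new rate
  have h231 : 2 * (4 : ℝ) * (Mb : ℝ) ^ 4 * Real.exp (-((aw + 40 * Real.log Mb) / 10)) ≤ (aw + 40 * Real.log Mb) / 20 := by
    have hsplit : Real.exp (-((aw + 40 * Real.log Mb) / 10)) = Real.exp (-(aw / 10)) * ((Mb : ℝ) ^ 4)⁻¹ := by
      have h4 : Real.exp (4 * Real.log (Mb : ℝ)) = (Mb : ℝ) ^ 4 := by
        rw [show (4 : ℝ) * Real.log (Mb : ℝ) = Real.log ((Mb : ℝ) ^ 4) by rw [Real.log_pow]; push_cast; ring]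
        exact Real.exp_log (by positivity)
      calc Real.exp (-((aw + 40 * Real.log Mb) / 10)) = Real.exp (-(aw / 10) + -(4 * Real.log (Mb : ℝ))) := by congr 1; ring
        _ = Real.exp (-(aw / 10)) * Real.exp (-(4 * Real.log (Mb : ℝ))) := Real.exp_add _ _
        _ = Real.exp (-(aw / 10)) * ((Mb : ℝ) ^ 4)⁻¹ := by rw [Real.exp_neg (4 * Real.log (Mb : ℝ)), h4]
    have hM4 : (Mb : ℝ) ^ 4 * ((Mb : ℝ) ^ 4)⁻¹ = 1 := mul_inv_cancel₀ (by positivity)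
    have h1 := N.h231
    calc 2 * (4 : ℝ) * (Mb : ℝ) ^ 4 * Real.exp (-((aw + 40 * Real.log Mb) / 10))
        = 2 * 4 * ((Mb : ℝ) ^ 4 * ((Mb : ℝ) ^ 4)⁻¹) * Real.exp (-(aw / 10)) := by rw [hsplit]; ring
      _ = 2 * (4 : ℝ) * ((1 : ℕ) : ℝ) ^ 4 * Real.exp (-(aw / 10)) := by rw [hM4]; norm_num
      _ ≤ aw / 20 := h1
      _ ≤ (aw + 40 * Real.log Mb) / 20 := by linarith
  have hexp20 : Real.exp (-((aw + 40 * Real.log Mb) / 20)) ≤ Real.exp (-(aw / 20)) := Real.exp_le_exp.2 (by linarith)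
  exact
    { hℓ := N.hℓ
      hα₆ := N.hα₆
      hε₀ := N.hε₀
      hδ := N.hδ
      hδ7 := N.hδ7
      hκ := N.hκ
      ha := by linarith [N.ha]
      hR15 := N.hR15
      hR16 := N.hR16.trans (by linarith)
      hR16' := N.hR16'.trans (by linarith)
      hR17 := hexp20.trans N.hR17
      h231 := h231
      ha₂ := N.ha₂
      hκ229 := N.hκ229
      hsm229 := N.hsm229
      habsk := (mul_le_mul_of_nonneg_right hexp20 (by norm_num)).trans N.habsk
      h18half := by
        have h := N.h18half
        unfold B13Step237.R18half at h ⊢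
        exact (memberF_mono _ N.hε₀ hX).trans h
      h18 := by
        have h := N.h18
        unfold B13Step237.R18sharp at h ⊢
        refine le_trans ?_ h
        refine mul_le_mul_of_nonneg_right ?_ (Real.exp_pos _).le
        show 2 * B13Step237.memberF (constsQ8A M a) _ ≤ 2 * B13Step237.memberF (constsQ8A M a) _
        exact mul_le_mul_of_nonneg_left (memberF_mono _ N.hε₀ hX) (by norm_num)
      ha₂' := N.ha₂'
      hκ229' := N.hκ229'
      hsm229' := N.hsm229'
      hR20 := N.hR20
      ha₅ := N.ha₅
      habs := N.habs
      hAc := N.hAc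
      hC3 := by
        have h := N.hC3
        refine le_trans ?_ h
        have hα₆ := N.hα₆
        refine mul_le_mul_of_nonneg_right ?_ (Real.exp_pos _).le
        refine div_le_div_of_nonneg_right ?_ hα₆.le
        show 2 * B13Step237.memberF (constsQ8A M a) _ ≤ 2 * B13Step237.memberF (constsQ8A M a) _
        exact mul_le_mul_of_nonneg_left (memberF_mono _ N.hε₀ hX) (by norm_num) }

end Bond

/-! ## §2. The activity-given joint witness at the junction's arity `(m₃ + 1, L∕2)` -/

/-- ★★ **JOINT NON-VACUITY, ACTIVITY LETTER GIVEN, AT EVERY BOND FINENESS.**  `junction_numerals_joint_witness_of_activity` with the junction's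
`hN` at bond-cube side `m₃ + 1` (the layer's (2.3) fineness) and transfer factor `L∕2`, the Lemma-3 rate being `aw + 40·log(m₃ + 1)`, and p. 17's
`hPa` at the same rate; the record `c = constsQ8A M α₄`, the `cp`, the admissible reference package, the explicit prefactors `K K′` and every other
conjunct VERBATIM.  Consistency of typed inequality lists; nothing about Bałaban's constants.
[cite: Balaban1988RG2Cluster, (2.3) p.12, (1.29) p.8, Lemma 1 (1.36) p.9, Lemma 2 (1.43) p.11, p.13, p.15, (2.16)–(2.18) p.16, (2.22) p.16, (2.24)-(2.26) p.17, (2.29)–(2.32) p.18, p.21 (closing paragraph); Balaban1985BackgroundPropagators, Thm 3.10 p.416; Balaban1984PropagatorsII, Lemma 2.1 (2.61) p.234] -/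
theorem junction_numerals_joint_witness_of_activity_bond {a K₂ : ℝ} (ha : 0 < a) (hK₂ : 0 < K₂) (m₂ m₃ : ℕ)
    (m ν m' mF c₀ : ℕ) (rC : ℝ) {BΔ : ℝ} (hB : 0 ≤ BΔ) :
    ∃ (c cp : B13.Consts) (rf : RefPackage) (K K' R₁ θ₀ α θ₁ R r γ₂ rP ρΔ ηΔ μΔ M₁ : ℝ),
      -- (0) the record at the given dial; explicit positive prefactors
      (∃ M : ℝ, κw + 1 ≤ M ∧ c = constsQ8A M a) ∧ c.α₄ = a ∧
      (0 < K ∧ K = a * ε₁t * Real.exp κ₁t / (2 * (K₀ 64 8 * (2 * (6 * ((8 : ℕ) : ℝ)) ^ 4) * Real.exp 1 * Real.exp ((1 / 8) * κ₁t * (12 ^ 4 - 1)))) ∧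
        0 < K' ∧ K' = a * ε₁t * Real.exp κ₁t / (2 * (2 * 64 * 1344 * K₀ 64 8))) ∧
      -- (1) the junction's `hN` AT BOND FINENESS `m₃ + 1`, `hτ2`, `h12`, `hL8`, `hE hε hC₁ hα hM`
      (Lemma3Numerics c (m₃ + 1) ((c.L : ℝ) / 2) (aw + 40 * Real.log ((m₃ + 1 : ℕ) : ℝ)) 1 1 (1 / 2) 1 ∧
        c.E₀ * c.ε₁ * c.C₁ * c.α₄⁻¹ * c.M ^ c.q * Real.exp (c.C₂ * c.κ₁) ≤ 1 / 2 ∧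
        R12 c ∧ 8 ≤ c.L ∧ 0 < c.E₀ ∧ 0 < c.ε₁ ∧ 0 < c.C₁ ∧ 0 < c.α₄ ∧ 1 ≤ c.M) ∧
      -- (2) the Lemma 1–2 located NUMERICAL inputs: `hK hK' hθ₁0 hθ₁1 hC`, `hK₂ hR hε3 hfloor`, `hκp`, `hr hr1`
      (0 ≤ K ∧ 0 ≤ K' ∧ 0 ≤ θ₁ ∧ θ₁ < 1 ∧
        K * K₀ 64 8 * (2 * (6 * ((c.L : ℕ) : ℝ)) ^ 4) * Real.exp 1 * Real.exp ((1 / 8) * c.κ₁ * (12 ^ 4 - 1)) +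
            2 * (64 * K') * K₀ 64 8 * 1344 ≤
          (1 - θ₁) * (c.E₀ * c.ε₁ * c.C₁ * c.M ^ c.q * Real.exp (c.C₂ * c.κ₁))) ∧
      (0 ≤ K₂ ∧ 0 < R ∧ 3 * c.ε₁ ≤ R ∧ 27 * m₂ * K₂ * Real.exp (c.κ₁ - 1) ≤ c.C₃ * c.M ^ 4 * Real.exp (c.C₂ * c.κ₁)) ∧
      c.κ₁ < cp.κ₁ ∧ (0 < r ∧ r ≤ 1) ∧
      -- (3) the rung at ONE admissible reference package, dials located
      (rf.Admissible ∧ R₁ = radiusStar rf.R rf.m₀ rf.mA₀ rf.KbarP rf.KbarA rf.cV rf.cV₀ ∧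
        (rf.toWalkPackage R₁).PositiveRates ∧ rf.η ≤ (rf.toWalkPackage R₁).etaMax ∧
        θ₀ = theta0Max m ν (rf.toWalkPackage R₁).kapCStar (rf.toWalkPackage R₁).Kbar (8 / rf.mA₀) (2 / rf.mA₀)
          (rf.toWalkPackage R₁).BΓ rf.cV (B6.c0 1 rf.η) rf.mA₀ ∧ 0 < θ₀ ∧
        0 < α ∧ α ≤ alphaMax θ₀ R₁ (rf.toWalkPackage R₁).Kbar ∧
        rsigmaMin θ₀ (rf.toWalkPackage R₁).Kbar (rf.toWalkPackage R₁).mu (rf.toWalkPackage R₁).kapCStar rf.m₀ rf.mA₀ rf.KbarP rf.KbarA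
          rf.cV rf.cV₀ rf.εP rf.εA ≤ rf.Rσ ∧
        ν ≤ rf.dm ∧ rf.εL ≤ rf.εP ∧ rf.kapL ≤ rf.kapP ∧ rf.KbarP ≤ rf.KbarL ∧ rf.εA ≤ rf.εP ∧ rf.kapA ≤ rf.kapP ∧
        rf.KbarP ≤ rf.KbarA ∧ rf.mA₀ ≤ rf.m₀) ∧
      -- (4) NODE A's rate budget and expansion-constant floor at `cp.κ₁`
      (0 < ηΔ ∧ 2 * cp.κ₁ ≤ ηΔ * M₁ ∧ 0 < μΔ ∧ ηΔ + rf.εP + rf.kapP + 4 * μΔ ≤ ρΔ ∧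
        kbarFloor ν mF c₀ ρΔ ηΔ μΔ rC cp.κ₁ BΔ ≤ rf.KbarP) ∧
      -- (5) the (2.24)–(2.26) located numerals + p. 17's `a ≤ γ₂ r_P²` AT THE MATCHING RATE
      (0 < γ₂ ∧ γ₂ ≤ gamma2Max m ν (2 / rf.mA₀) (rf.toWalkPackage R₁).BΓ rf.cV (B6.c0 1 rf.η) rf.mA₀ ∧
        m4Min m ν m' (2 / rf.mA₀) (rf.toWalkPackage R₁).BΓ rf.cV (B6.c0 1 rf.η) rf.mA₀ c.α₄ c.κ₁ ≤ c.M ^ 4 ∧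
        0 < rP ∧ aw + 40 * Real.log ((m₃ + 1 : ℕ) : ℝ) ≤ γ₂ * rP ^ 2) := by
  obtain ⟨c, cp, rf, K, K', R₁, θ₀, α, θ₁, R, r, γ₂, rP, ρΔ, ηΔ, μΔ, M₁, ⟨M, hM, rfl⟩, hα₄, hKK, ⟨-, h1⟩, h2, h2', hκp, hr, h3, h4,
    ⟨hγ, hγle, hM4, -, -⟩⟩ := junction_numerals_joint_witness_of_activity ha hK₂ m₂ m ν m' mF c₀ rC hB
  -- the new rate is positive; p. 17's coupling at it
  have haw : 0 < aw := aw_pos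
  have hlog : 0 ≤ Real.log ((m₃ + 1 : ℕ) : ℝ) := Real.log_nonneg (by exact_mod_cast Nat.succ_le_succ (Nat.zero_le m₃))
  have hB' : 0 < aw + 40 * Real.log ((m₃ + 1 : ℕ) : ℝ) := by linarith
  have hs : 0 < Real.sqrt ((aw + 40 * Real.log ((m₃ + 1 : ℕ) : ℝ)) / γ₂) := Real.sqrt_pos.2 (div_pos hB' hγ)
  have hPa : aw + 40 * Real.log ((m₃ + 1 : ℕ) : ℝ) ≤ γ₂ * Real.sqrt ((aw + 40 * Real.log ((m₃ + 1 : ℕ) : ℝ)) / γ₂) ^ 2 := by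
    rw [Real.sq_sqrt (div_pos hB' hγ).le]
    exact le_of_eq (by field_simp)
  exact ⟨constsQ8A M a, cp, rf, K, K', R₁, θ₀, α, θ₁, R, r, γ₂, Real.sqrt ((aw + 40 * Real.log ((m₃ + 1 : ℕ) : ℝ)) / γ₂), ρΔ, ηΔ, μΔ, M₁,
    ⟨M, hM, rfl⟩, hα₄, hKK, ⟨constsQ8A_numerics_bond hM ha (m₃ + 1) (Nat.succ_le_succ (Nat.zero_le m₃)), h1⟩, h2, h2', hκp, hr, h3, h4,
    ⟨hγ, hγle, hM4, hs, hPa⟩⟩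

/-! ## §3. The located bound on the (1.24) prefactor from the displayed shapes ALONE -/

/-- ★ **WHAT THE JUNCTION's SHAPES SAY ABOUT THE (1.24) PREFACTOR at any inhabitant with one term of non-empty 𝐃-support.**  From the displayed
binders ALONE — `hC` (the (1.36) constant inequality), `hτ2` ((2.18)), `0 ≤ θ₁ ≤ 1`, the θ-free count `hcount` at ONE term with `#⋃𝐃 ≥ 1`
(cardinals `nΛ nΛC ≥ 0`, volume `|Z| ≥ 0`), the `Lemma3Numerics` fields `habs hAc hδ7 hκ`, and the Lemma-1 threshold R8 `(1 − δ)κ ≤ ¼(κ₁ − 1)`: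
`K ≤ (κ₁ − 1)·ℓ·|Z|·e^{−1−(12⁴−1)κ₁∕8} ∕ (6144·K₀(64,8)²·2(6L)⁴·#⋃𝐃)`.  Reading: at a non-degenerate record the (1.24) prefactor delivered to
`h124` must be `e^{−(12⁴−1)κ₁∕8}`-small times the volume — print's per-term bound carries `E₀ε₁` ((1.29) p. 8) and `ε₁` is chosen after `κ₁`
(p. 21); a locator, not a gap. [cite: Balaban1988RG2Cluster, (1.24) p.7 (used p.8), (1.29) p.8, (1.36) p.9, (2.18) p.16, (2.24)-(2.26) p.17, p.20 (restrictions), p.21 (closing paragraph)] -/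
theorem K_le_of_junction_shapes (c : B13.Consts) {K K' θ₁ a₅ Aabs ℓ nΛ nΛC nD vol : ℝ} {L : ℕ}
    (hθ₁0 : 0 ≤ θ₁) (hθ₁1 : θ₁ ≤ 1) (hK' : 0 ≤ K') (hα : 0 < c.α₄) (hL : 1 ≤ L)
    (hC : K * K₀ 64 8 * (2 * (6 * ((L : ℕ) : ℝ)) ^ 4) * Real.exp 1 * Real.exp ((1 / 8) * c.κ₁ * (12 ^ 4 - 1)) +
        2 * (64 * K') * K₀ 64 8 * 1344 ≤ (1 - θ₁) * (c.E₀ * c.ε₁ * c.C₁ * c.M ^ c.q * Real.exp (c.C₂ * c.κ₁)))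
    (hτ2 : c.E₀ * c.ε₁ * c.C₁ * c.α₄⁻¹ * c.M ^ c.q * Real.exp (c.C₂ * c.κ₁) ≤ 1 / 2)
    (hΛ : 0 ≤ nΛ) (hΛC : 0 ≤ nΛC) (hD : 1 ≤ nD) (hvol : 0 ≤ vol)
    (hcount : 2 * nΛ + nΛC / 2 + 2 * (K₀ 64 8 * c.α₄ * nD) ≤ a₅ * vol)
    (habs : a₅ + Real.exp (-((c.κ₁ - 1) / 2)) ≤ Aabs) (hAc : Aabs * 64 ≤ c.δ * ℓ * c.κ)
    (hδ7 : 0 ≤ 1 - 7 * c.δ) (hκ : 0 ≤ c.κ) (hℓ : 0 ≤ ℓ)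
    (hR8 : (1 - c.δ) * c.κ ≤ (1 / 4) * (c.κ₁ - 1)) :
    K ≤ (c.κ₁ - 1) * ℓ * vol * Real.exp (-1 - (1 / 8) * c.κ₁ * (12 ^ 4 - 1)) /
      (6144 * K₀ 64 8 ^ 2 * (2 * (6 * ((L : ℕ) : ℝ)) ^ 4) * nD) := by
  have hK₀ : 0 < K₀ 64 8 := K₀_pos 64 8
  have hL' : (1 : ℝ) ≤ ((L : ℕ) : ℝ) := by exact_mod_cast hL
  set E := Real.exp (-1 - (1 / 8) * c.κ₁ * (12 ^ 4 - 1)) with hE_def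
  have hE : 0 < E := Real.exp_pos _
  set P := 2 * (6 * ((L : ℕ) : ℝ)) ^ 4 with hP_def
  have hP : 0 < P := by positivity
  -- (1) the prefactor against the activity letter; (2) the activity letter against the support ratio
  have h1 : K ≤ c.α₄ * E / (2 * K₀ 64 8 * P) := K_le_of_hC_hτ2 c hθ₁0 hθ₁1 hK' hα hC hτ2 hL
  have h2 : c.α₄ ≤ a₅ * vol / (2 * K₀ 64 8 * nD) := (alpha4_le_of_count c hΛ hΛC hD hcount).2
  -- (3) `a₅ ≤ δℓκ/64 ≤ (κ₁ − 1)ℓ/1536` from `habs hAc hδ hδ7 hκ hR8`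
  have hδκ : c.δ * c.κ * 24 ≤ c.κ₁ - 1 := by nlinarith
  have ha₅ : a₅ ≤ (c.κ₁ - 1) * ℓ / 1536 := by
    have hexp : 0 < Real.exp (-((c.κ₁ - 1) / 2)) := Real.exp_pos _
    have h3 : a₅ * 64 ≤ c.δ * c.κ * ℓ := by nlinarith
    nlinarith [mul_le_mul_of_nonneg_right hδκ hℓ]
  -- assemble
  have hden : 0 < 2 * K₀ 64 8 * nD := by nlinarith
  have h4 : c.α₄ ≤ (c.κ₁ - 1) * ℓ / 1536 * vol / (2 * K₀ 64 8 * nD) :=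
    h2.trans (div_le_div_of_nonneg_right (mul_le_mul_of_nonneg_right ha₅ hvol) hden.le)
  have h5 : K ≤ ((c.κ₁ - 1) * ℓ / 1536 * vol / (2 * K₀ 64 8 * nD)) * E / (2 * K₀ 64 8 * P) :=
    h1.trans (div_le_div_of_nonneg_right (mul_le_mul_of_nonneg_right h4 hE.le) (by positivity))
  have hnD : 0 < nD := by linarith
  calc K ≤ ((c.κ₁ - 1) * ℓ / 1536 * vol / (2 * K₀ 64 8 * nD)) * E / (2 * K₀ 64 8 * P) := h5
    _ = (c.κ₁ - 1) * ℓ * vol * E / (6144 * K₀ 64 8 ^ 2 * P * nD) := by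
        field_simp
        ring

end Literature.MathematicalPhysics.QuantumFieldTheory.Balaban1983to89.B13ChainJointNonvacuityPrefactorsBond

end
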